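import Literature.Geometry.Riemannian.RiemannianCoveringComplete
import Literature.Geometry.Riemannian.HopfRinowHeineBorel
import Literature.Geometry.Riemannian.CyclicCoverDistance
import HarnessLib

/-!
# The infinite cyclic cover of a compact Riemannian manifold is a proper metric space on which
the deck group acts cocompactly

The metric-space properties of the Riemannian `ℤ`-covers `(M̂ᵢ, ĝᵢ, Hᵢ ≅ ℤ)` of closed
manifolds used in H. Huang, X.-T. Huang, J. Wang, X. Zhu, arXiv:2605.24380 (2026), §4 (p. 13:
"`M̂ᵢ/Hᵢ = Mᵢ` … passing to a subsequence, `(M̂ᵢ, p̂ᵢ, Hᵢ)` pointed equivariant Gromov–Hausdorff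
converge"; the convergence of §2.1, Thm. 2.1 (Fukaya–Yamaguchi) is for proper length spaces with
closed groups of isometries), in the case `b = 1` of the infinite cyclic cover
`X̂ = CircleMaps.CyclicCover f` of a manifold `X` along `f : X → S¹` with its lifted metric
`ĝ = proj^* g` (`CyclicCoverMetric.lean`) and Riemannian distance `d̂` — assembled from
`RiemannianCoveringComplete.lean` (O'Neill 1983, Ch. 7, Cor. 29: `X̂` is geodesically complete when
`X` is), `HopfRinowHeineBorel.lean` (O'Neill 1983, Ch. 5, Thm. 21: complete ⇒ closed balls compact)
and `CyclicCoverDistance.lean` (the `ℤ`-orbits are `diam(X)`-dense):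

* `contMDiffCovariantDerivative_leviCivita_liftMetric` — the Levi-Civita connection of `ĝ` is `C¹`
  (Gallot–Hulin–Lafontaine 2004, Prop. 2.54, the tree's `isLocallyContMDiff_leviCivita_holds`);
* `isCompact_setOf_edist_liftMetric_le` — **closed `d̂`-balls of a connected cyclic cover of a
  complete manifold are compact**, and `…_of_compactSpace` for a compact base;
  `exists_isMinimizingUpTo_liftMetric` — any two of its points are joined by a minimizing geodesic
  (O'Neill 1983, Ch. 5, Prop. 22), so `(X̂, d̂)` is a proper geodesic space;
* `exists_isCompact_forall_exists_vadd_mem` — **the deck action is cocompact**: for a compact base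
  there is a compact `K ⊆ X̂` (a closed `d̂`-ball) meeting every `ℤ`-orbit, i.e. `ℤ +ᵥ K = X̂`
  ("`M̂ᵢ/Hᵢ = Mᵢ`" is compact).

Everything is proved; no definitions, no named facts (D-0026).

## References

* H. Huang, X.-T. Huang, J. Wang, X. Zhu, arXiv:2605.24380 (2026), §2.1 (p. 6), §4 (p. 13).
  [HuangHuangWangZhu2026]
* B. O'Neill, *Semi-Riemannian Geometry with Applications to Relativity* (1983), Ch. 5, Thm. 21,
  Cor. 23; Ch. 7, Cor. 29 and pp. 191–192. [ONeill1983]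
* S. Gallot, D. Hulin, J. Lafontaine, *Riemannian Geometry*, 3rd ed. (2004), Prop. 2.54.
  [GallotHulinLafontaine2004]
-/

noncomputable section

open Bundle Set Filter Function
open scoped Manifold ContDiff Topology ENNReal NNReal

namespace Literature.Geometry.Riemannian

open Literature.Geometry.Lorentzian Literature.Geometry.Lorentzian.PseudoRiemannianMetric
  Literature.Geometry.Manifold Literature.Topology.FourManifolds.CircleMaps
  Literature.Topology.FourManifolds.CircleMaps.CyclicCover

variable {E : Type*} [NormedAddCommGroup E] [NormedSpace ℝ E]
  {H : Type*} [TopologicalSpace H] {I : ModelWithCorners ℝ E H}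
  {X : Type*} [TopologicalSpace X] [ChartedSpace H X] [IsManifold I ∞ X]
  [FiniteDimensional ℝ E] [CompleteSpace E] [T2Space X] [I.Boundaryless]
  (f : C(X, Circle)) (g : PseudoRiemannianMetric I ∞ E (TangentSpace I : X → Type _))
  [g.HasLeviCivita] [(liftMetric f g).HasLeviCivita]

omit [T2Space X] [I.Boundaryless] [g.HasLeviCivita] in
/-- The Levi-Civita connection of the lifted metric is `C¹` (the lifted metric is `C^∞`;
Gallot–Hulin–Lafontaine 2004, Prop. 2.54, `isLocallyContMDiff_leviCivita_holds`).
[cite: GallotHulinLafontaine2004, Prop. 2.54] -/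
theorem contMDiffCovariantDerivative_leviCivita_liftMetric :
    CovariantDerivative.ContMDiffCovariantDerivative (liftMetric f g).leviCivita 1 :=
  ⟨(liftMetric f g).isLocallyContMDiff_leviCivita_holds 1
    (by rw [show ((1 : ℕ∞) : ℕ∞ω) + 1 = 2 by norm_num]; exact WithTop.coe_le_coe.2 le_top)
    univ isOpen_univ⟩

/-- **Closed balls of a connected cyclic cover of a complete Riemannian manifold are compact**:
if the Levi-Civita connection of the Riemannian `g` is geodesically complete and the infinite
cyclic cover `X̂` of `X` along `f` is connected, every closed ball `{q̂ | d̂(p̂, q̂) ≤ r}` of the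
Riemannian distance of the lifted metric `proj^* g` is compact (`X̂` is geodesically complete,
O'Neill 1983, Ch. 7, Cor. 29, `isGeodesicallyComplete_liftMetric`; Hopf–Rinow, Ch. 5, Thm. 21,
(C) ⇒ (HB), `isCompact_setOf_edist_le`). [cite: ONeill1983, Ch. 5, Thm. 21 and Ch. 7, Cor. 29] -/
theorem isCompact_setOf_edist_liftMetric_le [ConnectedSpace (CyclicCover f)] (hg : g.IsRiemannian)
    (hc : IsGeodesicallyComplete g.leviCivita) (p : CyclicCover f) (r : ℝ≥0) :
    IsCompact {q | (liftMetric f g).edist (isRiemannian_liftMetric f g hg) p q ≤ r} := by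
  haveI := contMDiffCovariantDerivative_leviCivita_liftMetric f g
  exact isCompact_setOf_edist_le (liftMetric f g) le_rfl (isRiemannian_liftMetric f g hg)
    (isGeodesicallyComplete_liftMetric f g hc) p r

/-- **Any two points of a connected cyclic cover of a complete Riemannian manifold are joined by a
minimizing geodesic** of the lifted metric (Hopf–Rinow, O'Neill 1983, Ch. 5, Prop. 22, on the
complete cover: the tree's `exists_isMinimizingUpTo_of_isGeodesicallyComplete`): there is
`v ∈ T_p̂ X̂` with `γ_v|[0,1]` minimizing and `exp_p̂ v = q̂` — so `(X̂, d̂)` is a geodesic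
(length) space. [cite: ONeill1983, Ch. 5, Prop. 22 and Ch. 7, Cor. 29] -/
theorem exists_isMinimizingUpTo_liftMetric [ConnectedSpace (CyclicCover f)] (hg : g.IsRiemannian)
    (hc : IsGeodesicallyComplete g.leviCivita) (p q : CyclicCover f) :
    ∃ v : TangentSpace I p,
      IsMinimizingUpTo (liftMetric f g) (isRiemannian_liftMetric f g hg) p v 1 ∧
        riemannianExpMap (liftMetric f g) p v = q := by
  haveI := contMDiffCovariantDerivative_leviCivita_liftMetric f g
  exact exists_isMinimizingUpTo_of_isGeodesicallyComplete (liftMetric f g) le_rfl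
    (isRiemannian_liftMetric f g hg) (isGeodesicallyComplete_liftMetric f g hc) p q

/-- **Closed balls of a connected cyclic cover of a compact Riemannian manifold are compact**
(the covers `M̂ᵢ` of the closed manifolds `Mᵢ` in Huang–Huang–Wang–Zhu 2026, §4, are proper
metric spaces): O'Neill 1983, Ch. 5, Cor. 23 (compact ⇒ complete), Ch. 7, Cor. 29, Ch. 5,
Thm. 21. [cite: ONeill1983, Ch. 5, Thm. 21 and Ch. 7, Cor. 29] -/
theorem isCompact_setOf_edist_liftMetric_le_of_compactSpace [ConnectedSpace (CyclicCover f)]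
    [CompactSpace X] (hg : g.IsRiemannian) (p : CyclicCover f) (r : ℝ≥0) :
    IsCompact {q | (liftMetric f g).edist (isRiemannian_liftMetric f g hg) p q ≤ r} :=
  isCompact_setOf_edist_liftMetric_le f g hg
    (g.isGeodesicallyComplete_of_compactSpace (WithTop.coe_le_coe.2 le_top) hg) p r

/-- **The deck action on the cyclic cover of a compact manifold is cocompact**: if `X` is
compact and the cyclic cover `X̂` is connected, some compact `K ⊆ X̂` (a closed `d̂`-ball about
any chosen `p̂`, of radius exceeding `diam X`) meets every `ℤ`-orbit: `∀ x̂, ∃ k, k +ᵥ x̂ ∈ K`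
(the `ℤ`-orbit of `p̂` is `diam(X)`-dense, `exists_edist_vadd_lt`, and the deck translations are
`d̂`-isometries, `edist_liftMetric_vadd`). This is the compactness of `M̂ᵢ/Hᵢ = Mᵢ` in
Huang–Huang–Wang–Zhu 2026, §4, p. 13, in the form used for equivariant Gromov–Hausdorff limits.
[cite: HuangHuangWangZhu2026, §4 p. 13] -/
theorem exists_isCompact_forall_exists_vadd_mem [ConnectedSpace (CyclicCover f)] [CompactSpace X]
    (hg : g.IsRiemannian) (p : CyclicCover f) :
    ∃ K : Set (CyclicCover f), IsCompact K ∧ p ∈ K ∧ ∀ x : CyclicCover f, ∃ k : ℤ, k +ᵥ x ∈ K := by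
  -- the base is (pre)connected, being the image of the connected cover
  haveI : PreconnectedSpace X := ⟨by
    have h := (isPreconnected_univ (α := CyclicCover f)).image (proj : CyclicCover f → X)
      (continuous_proj (f := f)).continuousOn
    rwa [image_univ_of_surjective (proj_surjective (f := f))] at h⟩
  haveI : Nonempty X := ⟨proj p⟩
  -- a finite bound `d₀` for the distances from `proj p` in the compact base
  obtain ⟨x₀, -, hx₀⟩ := (isCompact_univ (X := X)).exists_isMaxOn univ_nonempty
    (((PseudoRiemannianMetric.continuous_edist hg).comp
      (Continuous.prodMk_right (proj p))).continuousOn)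
  set d₀ : ℝ≥0∞ := g.edist hg (proj p) x₀ with hd₀
  have hd₀top : d₀ < ⊤ := edist_lt_top hg (proj p) x₀
  have hle : ∀ y : X, g.edist hg (proj p) y ≤ d₀ := fun y ↦ hx₀ (mem_univ y)
  -- the radius `D = d₀ + 1`, as a finite `ℝ≥0`
  set D : ℝ≥0 := (d₀ + 1).toNNReal with hD
  have hDtop : d₀ + 1 ≠ ⊤ := ENNReal.add_ne_top.2 ⟨hd₀top.ne, ENNReal.one_ne_top⟩
  have hDcoe : ((D : ℝ≥0) : ℝ≥0∞) = d₀ + 1 := ENNReal.coe_toNNReal hDtop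
  refine ⟨{q | (liftMetric f g).edist (isRiemannian_liftMetric f g hg) p q ≤ D},
    isCompact_setOf_edist_liftMetric_le_of_compactSpace f g hg p D, ?_, fun x ↦ ?_⟩
  · show (liftMetric f g).edist (isRiemannian_liftMetric f g hg) p p ≤ D
    rw [PseudoRiemannianMetric.edist_self]
    exact zero_le
  · -- `d(proj x, proj p) < d₀ + 1`, so some translate `k +ᵥ p` is within `d₀ + 1` of `x`
    have hlt : g.edist hg (proj x) (proj p) < d₀ + 1 := by
      rw [PseudoRiemannianMetric.edist_comm hg]
      exact lt_of_le_of_lt (hle (proj x)) (ENNReal.lt_add_right hd₀top.ne one_ne_zero)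
    obtain ⟨k, hk⟩ := exists_edist_vadd_lt f hg hlt
    refine ⟨-k, ?_⟩
    show (liftMetric f g).edist (isRiemannian_liftMetric f g hg) p ((-k) +ᵥ x) ≤ D
    have hiso := edist_liftMetric_vadd f g hg (-k) x (k +ᵥ p)
    rw [neg_vadd_vadd] at hiso
    rw [PseudoRiemannianMetric.edist_comm (isRiemannian_liftMetric f g hg), hiso, hDcoe]
    exact hk.le

end Literature.Geometry.Riemannian
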